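import Literature.AlgebraicGeometry.ModuliOfAbelianVarieties.SiegelFramedCovariant
import Literature.AlgebraicGeometry.AbelianSchemes.PolarizedLevelFrameEmbedding
import Literature.AlgebraicGeometry.AbelianSchemes.PolarizedAbelianSchemeWithLevelBaseChange
import Literature.AlgebraicGeometry.AbelianSchemes.AbelianSchemeLDeltaBaseChange
import Literature.AlgebraicGeometry.AbelianSchemes.AbelianSchemeLDeltaFibreH0Rank
import Literature.AlgebraicGeometry.Modules.PushforwardHasRankOfFibreVanishing
import Literature.AlgebraicGeometry.Modules.PushforwardBaseChangeOpenImmersion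
import Literature.AlgebraicGeometry.Modules.PullbackFrame
import Literature.AlgebraicGeometry.AbelianVarieties.LineBundleTensorPower
import HarnessLib

/-!
# Every polarised abelian scheme with level structure is Zariski-locally linearly rigidifiable

Layer `Literature/AlgebraicGeometry/AbelianSchemes`, namespace `Literature.AlgebraicGeometry.AbelianSchemes.PolarizedAbelianSchemeWithLevel`.
THEOREMS ONLY (no definition, no named fact, no instance, no notation, no `sorry`).  Cell `hodgecm-mathlib` (D-0151), F-DAG F-8 input
(hLR) (B-plan2 (g13) in trust 09:04:37Z; author B-p06 (g12); census `B-provers/B-p06/g12/CENSUS-hLR-PolarizedLevelLocallyRigidifiable.B-p06g12.md`;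
consumers: the binder `hLR` of (8β-b) `SiegelModuliFrameSubfunctor` and of (8ε)).  Count-neutral capital: HC_CM is proved only modulo the
7 printed citations until rung 0 closes — nothing here bears on a summit statement.

[MumfordFogartyKirwan1994] Ch. 7 §2, Def. 7.5 (p. 130) / Prop. 7.6 (p. 136): for a polarised abelian scheme `(X/T, λ)`, `π_*(L^Δ(λ)³)` is
LOCALLY FREE OF RANK `m + 1 = 6^g · d` (Prop. 6.13 + Riemann–Roch), so LINEAR RIGIDIFICATIONS `𝒪_T^{m+1} ≅ π_*(L^Δ(λ)³)` exist Zariski-locally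
on `T`; each gives the embedding `X ↪ ℙ^m × T`.  In the tree's letters (★ (8α) `IsFrameRigidification`): for every locally Noetherian
`ℚ`-scheme `T` and every triple `P` over `T`, there is an open cover `𝒰` of `T` such that every restricted triple `P|_{𝒰ᵢ}` (★
`PolarizedAbelianSchemeWithLevel.baseChange`) carries a graph datum `Gr`, a rank-one frame system `F` of `L^Δ(λ)^{⊗3} = (Gr^*𝒫)^{⊗3}` and
a FRAME `e : 𝒪^{#J+1} ≅ π_*(L^Δ(λ)^{⊗3})` whose basis sections generate — i.e. the data of ★ `IsFrameRigidification J (P|_{𝒰ᵢ}) ι` with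
`ι` the embedding they define.

Road (all ★): on an affine open `V ⊆ T` (compact, Noetherian) `π_*(L^Δ(λ)³)` has rank `6^g·d` by ★ `hasRank_pushforward_of_forall_fieldPoint_of_compactSpace`
(B-p04) fed with `H¹ = 0` ★ `Polarization.subsingleton_ext_one_pullback_LDelta_tensorPow'` (B-p11, V4) and `h⁰ = 6^g·d` ★
`Polarization.finrank_secMod_pullback_LDelta_tensorPow` (B-p11, R3); ★ `exists_frameSystem_of_hasRank` gives a frame on an open `U ∋ t` of
`V`; the restricted triple over `U` has `π_U,* (L^Δ(λ_U)³) ≅ (π_* L^Δ(λ)³)|_U` by base change along the open immersion (★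
`isIso_pushforwardBaseChangeHom_of_isOpenImmersion`, B-p04) and `L^Δ(λ_U) ≅ pr^*L^Δ(λ)` (★ `IsBaseChangeVia.nonempty_iso_pullback_LDelta`);
generation of the frame sections is ★ (FS-b) `Polarization.isClosedImmersion_pointOfSections_of_frame_LDelta_three`.

* §1 `nonempty_pullback_tensorPow_three_iso_of_isBaseChangeVia` — `G^*(L^Δ(λ)^{⊗3}) ≅ L^Δ(λ′)^{⊗3}` for a pull-back of triples;
  `charZero_of_specHom` — a field mapping to a `ℚ`-scheme has characteristic `0`.
* §2 `hasRank_pushforward_LDelta_three_of_compactSpace` — over a quasi-compact locally Noetherian `ℚ`-base, `π_*(L^Δ(λ)^{⊗3})` has rank `6^g·d`.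
* §3 `exists_openCover_frame_LDelta_three` — Zariski-locally a frame `𝒪^{#J+1} ≅ π_*(L^Δ(λ)^{⊗3})` with generating sections exists
  (the data of ★ `IsFrameRigidification`, minus its definitional last clause `… = ι`);
  **`exists_openCover_isFrameRigidification`** — THE HEAD, in ★ (8α)'s letters: `∃ 𝒰, ∀ i, ∃ ι, (P|_{𝒰ᵢ}).IsFrameRigidification J ι`
  (the binder `hLR` of (8β-b) `SiegelModuliFrameSubfunctor` / (8ε), token for token).

## References
* [MumfordFogartyKirwan1994] D. Mumford, J. Fogarty, F. Kirwan, *Geometric Invariant Theory*, 3rd ed. (1994), Ch. 7 §2 Def. 7.5 (p. 130),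
  Prop. 7.6 (p. 136); Ch. 6 §2 Prop. 6.13 (p. 123).
* [MumfordAV1970] D. Mumford, *Abelian Varieties* (1970), §5 Cor. 2 (p. 50), §16 (Riemann–Roch).
* [Hartshorne1977] R. Hartshorne, *Algebraic Geometry* (1977), III Thm. 12.11 (p. 290); II Thm. 7.1.
-/

noncomputable section

-- Mathlib's `Over`/pull-back API and `Scheme.Modules` section API are stated across semireducible wrappers.
set_option backward.isDefEq.respectTransparency false

open CategoryTheory CategoryTheory.Limits AlgebraicGeometry TopologicalSpace
open CategoryTheory.Abelian

namespace Literature.AlgebraicGeometry.AbelianSchemes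

open Literature.AlgebraicGeometry.Motives Literature.AlgebraicGeometry.Modules Literature.AlgebraicGeometry.Morphisms
  Literature.AlgebraicGeometry.ModuliOfAbelianVarieties

namespace PolarizedAbelianSchemeWithLevel

variable {g N : ℕ} {δ : Fin g → ℕ}

/-! ## §1 Two bookkeeping lemmas -/

/-- **`G^*(L^Δ(λ)^{⊗3}) ≅ L^Δ(λ′)^{⊗3}` for a pull-back of triples** (`G^*L^Δ(λ) ≅ L^Δ(λ′)`, ★ `IsBaseChangeVia.nonempty_iso_pullback_LDelta`, and
line bundles with equal classes are isomorphic: `[G^*(L^{⊗3})] = G^*[L]³ = [L′]³`).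
[cite: MumfordFogartyKirwan1994, Ch. 7 §2 Definition 7.2 (p. 129) and Ch. 6 §2 Prop. 6.10 (p. 121)] [cite: Hartshorne1977, II Ex. 6.8 (a); III Ex. 4.5] -/
theorem nonempty_pullback_tensorPow_iso_of_isBaseChangeVia {S T : Scheme.{0}} {P' : PolarizedAbelianSchemeWithLevel g N δ T}
    {P : PolarizedAbelianSchemeWithLevel g N δ S} {f : T ⟶ S} {G : P'.A.X.left ⟶ P.A.X.left} {Ĝ : P'.D.hat.X.left ⟶ P.D.hat.X.left}
    (h : P'.IsBaseChangeVia P f G Ĝ)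
    (Gr : P.A.X.left ⟶ P.A.prodLeft P.D.hat) (hGr₁ : Gr ≫ pullback.fst P.A.X.hom P.D.hat.X.hom = 𝟙 _)
    (hGr₂ : Gr ≫ pullback.snd P.A.X.hom P.D.hat.X.hom = P.pol.lam.left)
    (Gr' : P'.A.X.left ⟶ P'.A.prodLeft P'.D.hat) (hGr'₁ : Gr' ≫ pullback.fst P'.A.X.hom P'.D.hat.X.hom = 𝟙 _)
    (hGr'₂ : Gr' ≫ pullback.snd P'.A.X.hom P'.D.hat.X.hom = P'.pol.lam.left) (n : ℕ) :
    Nonempty ((Scheme.Modules.pullback G).obj (tensorPow ((Scheme.Modules.pullback Gr).obj P.D.P) n) ≅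
      tensorPow ((Scheme.Modules.pullback Gr').obj P'.D.P) n) := by
  obtain ⟨φ⟩ := h.nonempty_iso_pullback_LDelta Gr hGr₁ hGr₂ Gr' hGr'₁ hGr'₂
  have hL : HasRank ((Scheme.Modules.pullback Gr).obj P.D.P) 1 := hasRank_pullback Gr P.D.hasRank_one
  have hL' : HasRank ((Scheme.Modules.pullback Gr').obj P'.D.P) 1 := hasRank_pullback Gr' P'.D.hasRank_one
  obtain ⟨ψ⟩ := nonempty_pullback_tensorPow_iso G hL n
  refine ⟨ψ ≪≫ Classical.choice ?_⟩
  have hF := HasRank.isFiniteLocallyFree' hL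
  have hF' := HasRank.isFiniteLocallyFree' hL'
  rw [nonempty_iso_iff_detClass_eq (hasRank_tensorPow_one (hasRank_pullback G hL) n) (hasRank_tensorPow_one hL' n)
    (isFiniteLocallyFree_tensorPow (hF.pullback G) n) (isFiniteLocallyFree_tensorPow hF' n),
    detClass_tensorPow (hasRank_pullback G hL) (hF.pullback G) n, detClass_tensorPow hL' hF' n, detClass_eq_of_iso φ (hF.pullback G) hF']

/-- **A field over a `ℚ`-scheme has characteristic `0`**: a morphism `Spec K → T → Spec ℚ` gives a ring map `ℚ → K`, injective.
[cite: Hartshorne1977, II Prop. 2.3] -/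
theorem charZero_of_specHom {K : Type} [Field K] {T : Scheme.{0}} (πT : T ⟶ Spec (.of ℚ)) (x : Spec (.of K) ⟶ T) : CharZero K := by
  let φ : ℚ →+* K :=
    (Scheme.ΓSpecIso (.of K)).commRingCatIsoToRingEquiv.toRingHom.comp
      (((x ≫ πT).appTop).hom.comp (Scheme.ΓSpecIso (.of ℚ)).commRingCatIsoToRingEquiv.symm.toRingHom)
  exact (RingHom.charZero_iff φ.injective).mp inferInstance

/-! ## §2 The rank of `π_*(L^Δ(λ)^{⊗3})` over a quasi-compact base -/

/-- **`π_*(L^Δ(λ)^{⊗3})` is locally free of rank `6^g · d`** over a quasi-compact locally Noetherian `ℚ`-scheme ([MumfordFogartyKirwan1994]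
Prop. 6.13 / Def. 7.5's `m + 1`): ★ `hasRank_pushforward_of_forall_fieldPoint_of_compactSpace` (cohomology and base change, Mumford §5 Cor. 2)
fed with the fibrewise vanishing `H¹(X_t, L^Δ(λ)³_t) = 0` (★ `Polarization.subsingleton_ext_one_pullback_LDelta_tensorPow'`) and the fibrewise rank
`h⁰ = (2·3)^g · d` (★ `Polarization.finrank_secMod_pullback_LDelta_tensorPow`, Riemann–Roch).
[cite: MumfordFogartyKirwan1994, Ch. 6 §2 Prop. 6.13 (p. 123) and Ch. 7 §2 Def. 7.5 (p. 130)] [cite: MumfordAV1970, §5 Cor. 2 (p. 50)] -/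
theorem hasRank_pushforward_LDelta_three_of_compactSpace {T : Scheme.{0}} [IsLocallyNoetherian T] [CompactSpace T]
    (πT : T ⟶ Spec (.of ℚ)) (P : PolarizedAbelianSchemeWithLevel g N δ T)
    (Gr : P.A.X.left ⟶ P.A.prodLeft P.D.hat) (hGr₁ : Gr ≫ pullback.fst P.A.X.hom P.D.hat.X.hom = 𝟙 _)
    (hGr₂ : Gr ≫ pullback.snd P.A.X.hom P.D.hat.X.hom = P.pol.lam.left) :
    HasRank ((Scheme.Modules.pushforward P.A.X.hom).obj (tensorPow ((Scheme.Modules.pullback Gr).obj P.D.P) 3))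
      (6 ^ g * polarizationDegree δ) := by
  haveI : IsProper P.A.X.hom := P.A.isProper
  haveI : Smooth P.A.X.hom := P.A.isSmooth
  have hL : IsFiniteLocallyFree (tensorPow ((Scheme.Modules.pullback Gr).obj P.D.P) 3) :=
    isFiniteLocallyFree_tensorPow (HasRank.isFiniteLocallyFree' (hasRank_pullback Gr P.D.hasRank_one)) 3
  refine hasRank_pushforward_of_forall_fieldPoint_of_compactSpace _ hL _
    (fun K _ X₀ i f₀ x H ↦ P.pol.subsingleton_ext_one_pullback_LDelta_tensorPow' P.A P.D Gr hGr₁ hGr₂ x H (by norm_num))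
    (fun K _ X₀ i f₀ x H ↦ ?_)
  haveI : CharZero K := charZero_of_specHom πT x
  rw [P.pol.finrank_secMod_pullback_LDelta_tensorPow P.A P.D P.relDim P.hasType Gr hGr₁ hGr₂ x H (by norm_num : 0 < 3)]

/-! ## §3 Zariski-local frames of `π_*(L^Δ(λ)^{⊗3})` -/

/-- **LOCAL FORM: around every point of the base there is an open immersion `w : W → T` over which the restricted triple carries a
frame of `π_*(L^Δ(λ)^{⊗3})` with generating sections** (the data of ★ `IsFrameRigidification` for `P|_W`).  Construction: an affine open
`V ∋ t` (§2: rank `6^g·d` there), a frame of `(π_* L^Δ(λ)³)|_V` on an open `U ∋ t` of `V` (★ `exists_frameSystem_of_hasRank`), re-indexed by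
`Fin (#J + 1)` and pulled back to the scheme `U` (★ `pullbackFrame`), then moved to `π_U,*(L^Δ(λ_U)³)` along «`π_*` commutes with the open
immersion `U → T`» (★ `isIso_pushforwardBaseChangeHom_of_isOpenImmersion`, Mathlib `pullbackComp`) and `pr^*(L^Δ(λ)³) ≅ L^Δ(λ_U)³` (§1);
the frame sections generate by ★ `Polarization.isClosedImmersion_pointOfSections_of_frame_LDelta_three` (Lefschetz on the geometric fibres).
[cite: MumfordFogartyKirwan1994, Ch. 7 §2 Def. 7.5 (p. 130) and Prop. 7.6 (p. 136)] [cite: Hartshorne1977, III Thm. 12.11 (p. 290)] -/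
theorem exists_openImmersion_frame_LDelta_three {T : Scheme.{0}} [IsLocallyNoetherian T] (πT : T ⟶ Spec (.of ℚ))
    (P : PolarizedAbelianSchemeWithLevel g N δ T) (J : Type) [Finite J] (hJ : Nat.card J + 1 = 6 ^ g * polarizationDegree δ)
    (t : T) :
    ∃ (W : Scheme.{0}) (w : W ⟶ T) (_ : IsOpenImmersion w), t ∈ Set.range w.base ∧
      ∃ (Gr : (P.baseChange w).A.X.left ⟶ (P.baseChange w).A.prodLeft (P.baseChange w).D.hat)
        (_ : Gr ≫ pullback.fst (P.baseChange w).A.X.hom (P.baseChange w).D.hat.X.hom = 𝟙 _)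
        (_ : Gr ≫ pullback.snd (P.baseChange w).A.X.hom (P.baseChange w).D.hat.X.hom = (P.baseChange w).pol.lam.left)
        (F : FrameSystem (tensorPow ((Scheme.Modules.pullback Gr).obj (P.baseChange w).D.P) 3)) (h1 : ∀ x, F.rank x = 1)
        (e : SheafOfModules.free (Fin (Nat.card J + 1)) ≅
          ((Scheme.Modules.pushforward (P.baseChange w).A.X.hom).obj
            (tensorPow ((Scheme.Modules.pullback Gr).obj (P.baseChange w).D.P) 3)).over ⊤),
        ⨆ k, ⨆ x, (P.baseChange w).A.X.left.basicOpen
          ((GeneratingSections.CocycleSections.ofFrameSystem F h1 fun j ↦ (basisSection e j :)).coeff k x) = ⊤ := by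
  classical
  haveI : IsProper P.A.X.hom := P.A.isProper
  -- the global graph datum and `M := L^Δ(λ)^{⊗3}`
  let Gr : P.A.X.left ⟶ P.A.prodLeft P.D.hat :=
    pullback.lift (𝟙 _) P.pol.lam.left (by rw [Category.id_comp, P.pol.lam_comp_hom])
  have hGr₁ : Gr ≫ pullback.fst P.A.X.hom P.D.hat.X.hom = 𝟙 _ := pullback.lift_fst _ _ _
  have hGr₂ : Gr ≫ pullback.snd P.A.X.hom P.D.hat.X.hom = P.pol.lam.left := pullback.lift_snd _ _ _
  let M : P.A.X.left.Modules := tensorPow ((Scheme.Modules.pullback Gr).obj P.D.P) 3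
  have hM : HasRank ((Scheme.Modules.pullback Gr).obj P.D.P) 1 := hasRank_pullback Gr P.D.hasRank_one
  -- an affine open `V ∋ t`; the rank of `(π_* M)|_V`
  obtain ⟨V, hV, htV, -⟩ := exists_isAffineOpen_mem_and_subset (U := ⊤) (Set.mem_univ t : t ∈ (⊤ : T.Opens))
  haveI : IsAffine (V : Scheme.{0}) := hV
  haveI : CompactSpace (V : Scheme.{0}) := isCompact_iff_compactSpace.mp hV.isCompact
  let PV := P.baseChange V.ι
  let GrV : PV.A.X.left ⟶ PV.A.prodLeft PV.D.hat :=
    pullback.lift (𝟙 _) PV.pol.lam.left (by rw [Category.id_comp, PV.pol.lam_comp_hom])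
  have hGrV₁ : GrV ≫ pullback.fst PV.A.X.hom PV.D.hat.X.hom = 𝟙 _ := pullback.lift_fst _ _ _
  have hGrV₂ : GrV ≫ pullback.snd PV.A.X.hom PV.D.hat.X.hom = PV.pol.lam.left := pullback.lift_snd _ _ _
  have hRV := PV.hasRank_pushforward_LDelta_three_of_compactSpace (V.ι ≫ πT) GrV hGrV₁ hGrV₂
  have HV : IsPullback (pullback.fst P.A.X.hom V.ι) (pullback.snd P.A.X.hom V.ι) P.A.X.hom V.ι := IsPullback.of_hasPullback _ _
  haveI := isIso_pushforwardBaseChangeHom_of_isOpenImmersion HV M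
  obtain ⟨φV⟩ := nonempty_pullback_tensorPow_iso_of_isBaseChangeVia (P.baseChange_isBaseChangeVia V.ι) Gr hGr₁ hGr₂ GrV hGrV₁ hGrV₂ 3
  let NV : (V : Scheme.{0}).Modules := (Scheme.Modules.pullback V.ι).obj ((Scheme.Modules.pushforward P.A.X.hom).obj M)
  have hRNV : HasRank NV (6 ^ g * polarizationDegree δ) :=
    hasRank_of_iso (asIso (pushforwardBaseChangeHom HV.w M) ≪≫
      (Scheme.Modules.pushforward (pullback.snd P.A.X.hom V.ι)).mapIso φV).symm hRV
  -- a frame of `(π_* M)|_V` on an open `U ∋ t` of `V`, re-indexed by `Fin (#J + 1)`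
  obtain ⟨F₀, hF₀⟩ := exists_frameSystem_of_hasRank hRNV
  let t' : (V : Scheme.{0}) := ⟨t, htV⟩
  let U : (V : Scheme.{0}).Opens := F₀.U t'
  haveI : Fintype (F₀.I t') := Fintype.ofEquiv _ (F₀.enum t').symm
  let eJ : Fin (Nat.card J + 1) ≃ F₀.I t' := (finCongr (hJ.trans (hF₀ t').symm)).trans (F₀.enum t').symm
  -- the chart `w : U → V → T` and the restricted triple
  let w : (U : Scheme.{0}) ⟶ T := U.ι ≫ V.ι
  let Pw := P.baseChange w
  let Grw : Pw.A.X.left ⟶ Pw.A.prodLeft Pw.D.hat :=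
    pullback.lift (𝟙 _) Pw.pol.lam.left (by rw [Category.id_comp, Pw.pol.lam_comp_hom])
  have hGrw₁ : Grw ≫ pullback.fst Pw.A.X.hom Pw.D.hat.X.hom = 𝟙 _ := pullback.lift_fst _ _ _
  have hGrw₂ : Grw ≫ pullback.snd Pw.A.X.hom Pw.D.hat.X.hom = Pw.pol.lam.left := pullback.lift_snd _ _ _
  obtain ⟨Fw, hFw⟩ := exists_frameSystem_of_hasRank (hasRank_tensorPow_one (hasRank_pullback Grw Pw.D.hasRank_one) 3)
  have Hw : IsPullback (pullback.fst P.A.X.hom w) (pullback.snd P.A.X.hom w) P.A.X.hom w := IsPullback.of_hasPullback _ _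
  haveI := isIso_pushforwardBaseChangeHom_of_isOpenImmersion Hw M
  obtain ⟨φw⟩ := nonempty_pullback_tensorPow_iso_of_isBaseChangeVia (P.baseChange_isBaseChangeVia w) Gr hGr₁ hGr₂ Grw hGrw₁ hGrw₂ 3
  -- the frame of `π_U,* (L^Δ(λ_U)³)` over `⊤`
  have hU : U.ι ⁻¹ᵁ U = ⊤ := U.ι_preimage_self
  let χ : (Scheme.Modules.pullback U.ι).obj NV ≅
      (Scheme.Modules.pushforward Pw.A.X.hom).obj (tensorPow ((Scheme.Modules.pullback Grw).obj Pw.D.P) 3) :=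
    (Scheme.Modules.pullbackComp U.ι V.ι).app _ ≪≫ asIso (pushforwardBaseChangeHom Hw.w M) ≪≫
      (Scheme.Modules.pushforward (pullback.snd P.A.X.hom w)).mapIso φw
  let e₂ : SheafOfModules.free (F₀.I t') ≅ ((Scheme.Modules.pullback U.ι).obj NV).over ⊤ :=
    SheafOfModules.restrictTrivialisation (R := (U : Scheme.{0}).ringCatSheaf) (eqToHom hU.symm)
      (pullbackFrame U.ι (F₀.frame t'))
  let e : SheafOfModules.free (Fin (Nat.card J + 1)) ≅
      ((Scheme.Modules.pushforward Pw.A.X.hom).obj (tensorPow ((Scheme.Modules.pullback Grw).obj Pw.D.P) 3)).over ⊤ :=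
    (SheafOfModules.freeFunctor (R := (U : Scheme.{0}).ringCatSheaf.over ⊤)).mapIso eJ.toIso ≪≫ e₂ ≪≫
      (SheafOfModules.overFunctor _ ⊤).mapIso χ
  -- the frame sections generate (Lefschetz on the geometric fibres)
  obtain ⟨hcov, -⟩ := AbelianSchemeOver.Polarization.isClosedImmersion_pointOfSections_of_frame_LDelta_three Pw.A Pw.D (w ≫ πT)
    Pw.pol Grw hGrw₁ hGrw₂ Fw hFw J e
  exact ⟨U, w, inferInstance, ⟨⟨t', F₀.mem t'⟩, rfl⟩, Grw, hGrw₁, hGrw₂, Fw, hFw, e, hcov⟩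

/-- **EVERY POLARISED ABELIAN SCHEME WITH LEVEL STRUCTURE OVER A LOCALLY NOETHERIAN `ℚ`-SCHEME IS ZARISKI-LOCALLY LINEARLY RIGIDIFIABLE**
([MumfordFogartyKirwan1994] Def. 7.5 / Prop. 7.6: `π_*(L^Δ(λ)³)` is locally free of rank `6^g·d`, so linear rigidifications exist locally): there is an
open cover `𝒰` of `T` such that every restricted triple `P|_{𝒰ᵢ}` carries a graph datum, a rank-one frame system of `L^Δ(λ)^{⊗3}` and a frame
`𝒪^{#J+1} ≅ π_*(L^Δ(λ)^{⊗3})` whose sections generate — the data of ★ `PolarizedAbelianSchemeWithLevel.IsFrameRigidification J (P|_{𝒰ᵢ}) ι` with `ι`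
the embedding they define (fold with `⟨Gr, _, _, F, h1, e, hcov, rfl⟩`).  The binder `hLR` of the slice construction of the fine moduli scheme.
[cite: MumfordFogartyKirwan1994, Ch. 7 §2 Def. 7.5 (p. 130) and Prop. 7.6 (p. 136)] [cite: Hartshorne1977, III Thm. 12.11 (p. 290)] -/
theorem exists_openCover_frame_LDelta_three {T : Scheme.{0}} [IsLocallyNoetherian T] (πT : T ⟶ Spec (.of ℚ))
    (P : PolarizedAbelianSchemeWithLevel g N δ T) (J : Type) [Finite J] (hJ : Nat.card J + 1 = 6 ^ g * polarizationDegree δ) :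
    ∃ 𝒰 : Scheme.OpenCover.{0} T, ∀ i,
      ∃ (Gr : (P.baseChange (𝒰.f i)).A.X.left ⟶ (P.baseChange (𝒰.f i)).A.prodLeft (P.baseChange (𝒰.f i)).D.hat)
        (_ : Gr ≫ pullback.fst (P.baseChange (𝒰.f i)).A.X.hom (P.baseChange (𝒰.f i)).D.hat.X.hom = 𝟙 _)
        (_ : Gr ≫ pullback.snd (P.baseChange (𝒰.f i)).A.X.hom (P.baseChange (𝒰.f i)).D.hat.X.hom = (P.baseChange (𝒰.f i)).pol.lam.left)
        (F : FrameSystem (tensorPow ((Scheme.Modules.pullback Gr).obj (P.baseChange (𝒰.f i)).D.P) 3)) (h1 : ∀ x, F.rank x = 1)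
        (e : SheafOfModules.free (Fin (Nat.card J + 1)) ≅
          ((Scheme.Modules.pushforward (P.baseChange (𝒰.f i)).A.X.hom).obj
            (tensorPow ((Scheme.Modules.pullback Gr).obj (P.baseChange (𝒰.f i)).D.P) 3)).over ⊤),
        ⨆ k, ⨆ x, (P.baseChange (𝒰.f i)).A.X.left.basicOpen
          ((GeneratingSections.CocycleSections.ofFrameSystem F h1 fun j ↦ (basisSection e j :)).coeff k x) = ⊤ := by
  choose W w hw hmem hdata using exists_openImmersion_frame_LDelta_three πT P J hJ
  refine ⟨Scheme.Cover.mkOfCovers T W w (fun x ↦ ?_) hw, fun i ↦ hdata i⟩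
  obtain ⟨y, hy⟩ := hmem x
  exact ⟨x, y, hy⟩

/-- **EVERY TRIPLE OVER A LOCALLY NOETHERIAN `ℚ`-SCHEME IS ZARISKI-LOCALLY LINEARLY RIGIDIFIABLE, in ★ (8α)'s letters**
([MumfordFogartyKirwan1994] Def. 7.5 / Prop. 7.6): there is an open cover `𝒰` of `T` such that every restricted triple `P|_{𝒰ᵢ}` admits a
morphism `ι : X|_{𝒰ᵢ} → 𝐏^{#J}_ℤ` which is the morphism of a global frame of `π_*(L^Δ(λ)^{⊗3})` — ★
`PolarizedAbelianSchemeWithLevel.IsFrameRigidification J (P|_{𝒰ᵢ}) ι` (so in particular `𝟙`-restricted it is a linear rigidification).  This is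
the binder `hLR` of (8β-b) `SiegelModuliFrameSubfunctor` and of (8ε), token for token.
[cite: MumfordFogartyKirwan1994, Ch. 7 §2 Def. 7.5 (p. 130) and Prop. 7.6 (p. 136)] [cite: Hartshorne1977, III Thm. 12.11 (p. 290)] -/
theorem exists_openCover_isFrameRigidification {T : Scheme.{0}} [IsLocallyNoetherian T] (πT : T ⟶ Spec (.of ℚ))
    (P : PolarizedAbelianSchemeWithLevel g N δ T) (J : Type) [Finite J] (hJ : Nat.card J + 1 = 6 ^ g * polarizationDegree δ) :
    ∃ 𝒰 : Scheme.OpenCover.{0} T, ∀ i, ∃ ι, (P.baseChange (𝒰.f i)).IsFrameRigidification J ι := by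
  obtain ⟨𝒰, h𝒰⟩ := exists_openCover_frame_LDelta_three πT P J hJ
  refine ⟨𝒰, fun i ↦ ?_⟩
  obtain ⟨Gr, hGr₁, hGr₂, F, h1, e, hcov⟩ := h𝒰 i
  exact ⟨_, Gr, hGr₁, hGr₂, F, h1, e, hcov, rfl⟩

/-! ## §4 (edition 2) Transport of a GIVEN frame of `π_*(L^Δ(λ)^{⊗3})` to a frame rigidification of the restricted triple

Edition 1 (§3) chose the frame itself.  The quasi-projectivity road (cell `hodgecm-mathlib`, F-9 (M1)) reads MFK's determinants in a
GLOBAL frame system of `E = π_*(L^Δ(λ)^{⊗3})` and needs, for EVERY member `E|_U ≅ 𝒪_U^{#J+1}` of that system, the frame rigidification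
of `P|_U` it induces — with its frame spelled out, so that the marked-point coordinates can be compared with the evaluation determinants
(★ `Modules/DeterminantSectionOfSections`). -/

/-- **ANY FRAME `eU : 𝒪_U^{#J+1} ≅ π_*(L^Δ(λ)^{⊗3})|_U` OVER AN OPEN `U ⊆ T` TRANSPORTS TO A FRAME RIGIDIFICATION OF `P|_U`**
([MumfordFogartyKirwan1994] Def. 7.5 / Prop. 7.6, the local-triviality half, for a PRESCRIBED trivialisation): with `w := U.ι`, the
restricted triple `P|_U = P.baseChange w`, its graph datum `Gr_w` and `M_w := L^Δ(λ_w)^{⊗3}`, there are a rank-one frame system `F_w`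
of `M_w`, an isomorphism `φ_w : pr^*(L^Δ(λ)^{⊗3}) ≅ M_w` (§1) and the frame
`e := η_w(eU) ≫ (π_* commutes with w) ≫ π_{w,*}φ_w` of `π_{w,*}M_w` over `⊤` (★ `pullbackFrame`, ★ `SheafOfModules.restrictTrivialisation`,
★ `isIso_pushforwardBaseChangeHom_of_isOpenImmersion`) whose sections GENERATE (★ `Polarization.isClosedImmersion_pointOfSections_of_frame_LDelta_three`,
Lefschetz on the geometric fibres) — i.e. exactly the data of ★ `IsFrameRigidification J (P.baseChange U.ι) ι` for the `ι` they define.  This is §3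
with the frame given rather than chosen. [cite: MumfordFogartyKirwan1994, Ch. 7 §2 Def. 7.5 (p. 130) and Prop. 7.6 (p. 136)]
[cite: Hartshorne1977, III Thm. 12.11 (p. 290)] -/
theorem exists_frame_transport_of_frame {T : Scheme.{0}} [IsLocallyNoetherian T] (πT : T ⟶ Spec (.of ℚ))
    (P : PolarizedAbelianSchemeWithLevel g N δ T) (J : Type) [Finite J]
    (Gr : P.A.X.left ⟶ P.A.prodLeft P.D.hat) (hGr₁ : Gr ≫ pullback.fst P.A.X.hom P.D.hat.X.hom = 𝟙 _)
    (hGr₂ : Gr ≫ pullback.snd P.A.X.hom P.D.hat.X.hom = P.pol.lam.left) (U : T.Opens)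
    (eU : SheafOfModules.free (Fin (Nat.card J + 1)) ≅
      ((Scheme.Modules.pushforward P.A.X.hom).obj (tensorPow ((Scheme.Modules.pullback Gr).obj P.D.P) 3)).over U) :
    ∃ (Grw : (P.baseChange U.ι).A.X.left ⟶ (P.baseChange U.ι).A.prodLeft (P.baseChange U.ι).D.hat)
      (_ : Grw ≫ pullback.fst (P.baseChange U.ι).A.X.hom (P.baseChange U.ι).D.hat.X.hom = 𝟙 _)
      (_ : Grw ≫ pullback.snd (P.baseChange U.ι).A.X.hom (P.baseChange U.ι).D.hat.X.hom = (P.baseChange U.ι).pol.lam.left)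
      (Fw : FrameSystem (tensorPow ((Scheme.Modules.pullback Grw).obj (P.baseChange U.ι).D.P) 3)) (hFw : ∀ x, Fw.rank x = 1)
      (φw : (Scheme.Modules.pullback (pullback.fst P.A.X.hom U.ι)).obj (tensorPow ((Scheme.Modules.pullback Gr).obj P.D.P) 3) ≅
        tensorPow ((Scheme.Modules.pullback Grw).obj (P.baseChange U.ι).D.P) 3)
      (_ : IsIso (pushforwardBaseChangeHom (IsPullback.of_hasPullback P.A.X.hom U.ι).w
        (tensorPow ((Scheme.Modules.pullback Gr).obj P.D.P) 3)))
      (e : SheafOfModules.free (Fin (Nat.card J + 1)) ≅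
        ((Scheme.Modules.pushforward (P.baseChange U.ι).A.X.hom).obj
          (tensorPow ((Scheme.Modules.pullback Grw).obj (P.baseChange U.ι).D.P) 3)).over ⊤)
      (_ : e = SheafOfModules.restrictTrivialisation (R := (U : Scheme.{0}).ringCatSheaf) (eqToHom U.ι_preimage_self.symm)
          (pullbackFrame U.ι eU) ≪≫
        (SheafOfModules.overFunctor _ ⊤).mapIso
          (asIso (pushforwardBaseChangeHom (IsPullback.of_hasPullback P.A.X.hom U.ι).w
              (tensorPow ((Scheme.Modules.pullback Gr).obj P.D.P) 3)) ≪≫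
            (Scheme.Modules.pushforward (pullback.snd P.A.X.hom U.ι)).mapIso φw))
      (hcov : ⨆ k, ⨆ x, (P.baseChange U.ι).A.X.left.basicOpen
        ((GeneratingSections.CocycleSections.ofFrameSystem Fw hFw fun j ↦ (basisSection e j :)).coeff k x) = ⊤),
      (P.baseChange U.ι).IsFrameRigidification J
        (projectiveSpace.homEquiv (Over.mk (P.baseChange U.ι).A.X.hom)
          (projectiveSpace.pointOfSections (Over.mk (P.baseChange U.ι).A.X.hom)
            (GeneratingSections.ofCocycleSections Fw.U
              (GeneratingSections.CocycleSections.ofFrameSystem Fw hFw fun j ↦ (basisSection e j :)) hcov))) := by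
  classical
  haveI : IsProper P.A.X.hom := P.A.isProper
  let M : P.A.X.left.Modules := tensorPow ((Scheme.Modules.pullback Gr).obj P.D.P) 3
  let w : (U : Scheme.{0}) ⟶ T := U.ι
  let Pw := P.baseChange w
  let Grw : Pw.A.X.left ⟶ Pw.A.prodLeft Pw.D.hat :=
    pullback.lift (𝟙 _) Pw.pol.lam.left (by rw [Category.id_comp, Pw.pol.lam_comp_hom])
  have hGrw₁ : Grw ≫ pullback.fst Pw.A.X.hom Pw.D.hat.X.hom = 𝟙 _ := pullback.lift_fst _ _ _
  have hGrw₂ : Grw ≫ pullback.snd Pw.A.X.hom Pw.D.hat.X.hom = Pw.pol.lam.left := pullback.lift_snd _ _ _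
  obtain ⟨Fw, hFw⟩ := exists_frameSystem_of_hasRank (hasRank_tensorPow_one (hasRank_pullback Grw Pw.D.hasRank_one) 3)
  have Hw : IsPullback (pullback.fst P.A.X.hom w) (pullback.snd P.A.X.hom w) P.A.X.hom w := IsPullback.of_hasPullback _ _
  haveI hiso := isIso_pushforwardBaseChangeHom_of_isOpenImmersion Hw M
  obtain ⟨φw⟩ := nonempty_pullback_tensorPow_iso_of_isBaseChangeVia (P.baseChange_isBaseChangeVia w) Gr hGr₁ hGr₂ Grw hGrw₁ hGrw₂ 3
  let e : SheafOfModules.free (Fin (Nat.card J + 1)) ≅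
      ((Scheme.Modules.pushforward Pw.A.X.hom).obj (tensorPow ((Scheme.Modules.pullback Grw).obj Pw.D.P) 3)).over ⊤ :=
    SheafOfModules.restrictTrivialisation (R := (U : Scheme.{0}).ringCatSheaf) (eqToHom U.ι_preimage_self.symm)
        (pullbackFrame U.ι eU) ≪≫
      (SheafOfModules.overFunctor _ ⊤).mapIso (asIso (pushforwardBaseChangeHom Hw.w M) ≪≫
        (Scheme.Modules.pushforward (pullback.snd P.A.X.hom w)).mapIso φw)
  -- the frame sections generate (Lefschetz on the geometric fibres)
  obtain ⟨hcov, -⟩ := AbelianSchemeOver.Polarization.isClosedImmersion_pointOfSections_of_frame_LDelta_three Pw.A Pw.D (w ≫ πT)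
    Pw.pol Grw hGrw₁ hGrw₂ Fw hFw J e
  exact ⟨Grw, hGrw₁, hGrw₂, Fw, hFw, φw, hiso, e, rfl, hcov, Grw, hGrw₁, hGrw₂, Fw, hFw, e, hcov, rfl⟩

end PolarizedAbelianSchemeWithLevel


end Literature.AlgebraicGeometry.AbelianSchemes

end
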